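import Literature.AlgebraicGeometry.Motives.UniversalHypersurfaceRegularLocusChartCoeff
import HarnessLib

/-!
# Submersivity in the chart coordinates from submersivity of the partial map in the affine variables

Family `hodge`, layer `Literature/AlgebraicGeometry/Motives`; sequel of `UniversalHypersurfaceRegularLocusChartCoeff` (the explicit coefficient
vector `regChartCoeffVec n d i (b', y)`: the coordinate `b'_m` off `xᵢ^d`, the solved value at `xᵢ^d`). The map `(b', y) ↦ (b, B(b', y))` whose
differential enters the chart criterion `UniversalHypersurfaceRegularLocusChartSubmersion.surjective_mfderiv_pair_of_surjective_fderiv` has the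
block form "identity on `b'`" plus the pair (solved coefficient, `B`): its differential is onto as soon as the differential of the PARTIAL map
`y ↦ (b_{xᵢ^d}(b'₀, y), B(b'₀, y))` is onto (solve for the `y`-increment after fixing the `b'`-increment).

* `extY n d i` — the inclusion `δy ↦ (0, δy)` of the affine directions; `hasFDerivAt_sumElim` — `y ↦ (b'₀, y)` has derivative `extY`;
* `fderiv_coeffVec_apply_of_ne` — the `m`-component (`m ≠ xᵢ^d`) of the differential of `(regChartCoeffVec, B)` is the coordinate `δb'_m`;
* `surjective_fderiv_coeffVec_prod_of_partial` — **if `D[y ↦ ((regChartCoeffVec (b'₀, y)) xᵢ^d, B (b'₀, y))](y₀)` is onto then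
  `D[(regChartCoeffVec, B)](b'₀, y₀)` is onto.**

Everything is proved; the one definition (`extY`) is a concrete continuous linear map; no named facts.

## References

* [BrockerJanichIDT1982] T. Bröcker, K. Jänich, Introduction to Differential Topology (1982), §5 (submersions in coordinates).
-/

noncomputable section

open Set Function

namespace Literature.AlgebraicGeometry.Motives.UniversalHypersurface

variable (n d : ℕ) (i : Fin (n + 2))

/-- The chart-coordinate index type `{m ≠ xᵢ^d} ⊕ Fin (n+1)` (local abbreviation). [cite: BrockerJanichIDT1982, §5] -/
abbrev ChartIdx : Type := {m : DegIndex n d // m ≠ regPowIndex n d i} ⊕ Fin (n + 1)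

/-- **The inclusion of the affine directions** `δy ↦ (0, δy)` as a real continuous linear map. [cite: BrockerJanichIDT1982, §5] -/
def extY : (Fin (n + 1) → ℂ) →L[ℝ] (ChartIdx n d i → ℂ) :=
  ContinuousLinearMap.pi (Sum.elim (fun _ => (0 : (Fin (n + 1) → ℂ) →L[ℝ] ℂ))
    (fun j => (ContinuousLinearMap.proj j : (Fin (n + 1) → ℂ) →L[ℝ] ℂ)))

/-- `extY δy (inl m) = 0`. [cite: BrockerJanichIDT1982, §5] -/
@[simp] theorem extY_apply_inl (δy : Fin (n + 1) → ℂ) (m : {m : DegIndex n d // m ≠ regPowIndex n d i}) :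
    extY n d i δy (Sum.inl m) = 0 := by
  simp [extY, ContinuousLinearMap.pi_apply]

/-- `extY δy (inr j) = δy j`. [cite: BrockerJanichIDT1982, §5] -/
@[simp] theorem extY_apply_inr (δy : Fin (n + 1) → ℂ) (j : Fin (n + 1)) :
    extY n d i δy (Sum.inr j) = δy j := by
  simp [extY, ContinuousLinearMap.pi_apply]

/-- `(b'₀, y) = (b'₀, 0) + extY y`. [cite: BrockerJanichIDT1982, §5] -/
theorem sumElim_eq_add_extY (x₀ : {m : DegIndex n d // m ≠ regPowIndex n d i} → ℂ) (y : Fin (n + 1) → ℂ) :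
    (Sum.elim x₀ y : ChartIdx n d i → ℂ) = Sum.elim x₀ (fun _ => (0 : ℂ)) + extY n d i y := by
  funext s
  rcases s with m | j
  · simp
  · simp

/-- `y ↦ (b'₀, y)` has derivative `extY`. [cite: BrockerJanichIDT1982, §5] -/
theorem hasFDerivAt_sumElim (x₀ : {m : DegIndex n d // m ≠ regPowIndex n d i} → ℂ) (y₀ : Fin (n + 1) → ℂ) :
    HasFDerivAt (fun y : Fin (n + 1) → ℂ => (Sum.elim x₀ y : ChartIdx n d i → ℂ)) (extY n d i) y₀ := by
  have h : (fun y : Fin (n + 1) → ℂ => (Sum.elim x₀ y : ChartIdx n d i → ℂ)) =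
      fun y => Sum.elim x₀ (fun _ => (0 : ℂ)) + extY n d i y := funext fun y => sumElim_eq_add_extY n d i x₀ y
  rw [h]
  exact ((extY n d i).hasFDerivAt).const_add _

/-- **The `m`-component (`m ≠ xᵢ^d`) of the differential of `(regChartCoeffVec, B)` is the coordinate increment `δb'_m`.**
[cite: BrockerJanichIDT1982, §5] -/
theorem fderiv_coeffVec_apply_of_ne {F : Type*} [NormedAddCommGroup F] [NormedSpace ℝ F]
    (B : (ChartIdx n d i → ℂ) → F) {v₀ : ChartIdx n d i → ℂ} (hB : DifferentiableAt ℝ B v₀)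
    {m : DegIndex n d} (hm : m ≠ regPowIndex n d i) (w : ChartIdx n d i → ℂ) :
    (fderiv ℝ (fun v => (regChartCoeffVec n d i v, B v)) v₀ w).1 m = w (Sum.inl ⟨m, hm⟩) := by
  have hG : DifferentiableAt ℝ (regChartCoeffVec n d i) v₀ :=
    ((contDiff_regChartCoeffVec n d i).differentiable (by simp)).differentiableAt
  rw [hG.fderiv_prodMk hB]
  change (fderiv ℝ (regChartCoeffVec n d i) v₀ w) m = _
  have hm' : HasFDerivAt (fun v => regChartCoeffVec n d i v m)
      (ContinuousLinearMap.proj (R := ℝ) (Sum.inl ⟨m, hm⟩ : ChartIdx n d i)) v₀ := by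
    have hfun : (fun v => regChartCoeffVec n d i v m) = fun v : ChartIdx n d i → ℂ => v (Sum.inl ⟨m, hm⟩) :=
      funext fun v => regChartCoeffVec_of_ne n d i v hm
    rw [hfun]
    exact hasFDerivAt_apply (Sum.inl ⟨m, hm⟩ : ChartIdx n d i) v₀
  have hcomp : HasFDerivAt (fun v => regChartCoeffVec n d i v m)
      ((ContinuousLinearMap.proj (R := ℝ) m).comp (fderiv ℝ (regChartCoeffVec n d i) v₀)) v₀ :=
    (hasFDerivAt_pi'.1 hG.hasFDerivAt) m
  have heq := hcomp.unique hm'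
  exact congrArg (fun L : (ChartIdx n d i → ℂ) →L[ℝ] ℂ => L w) heq

/-- **Block-triangular surjectivity**: if the differential at `y₀` of the partial map `y ↦ ((regChartCoeffVec (b'₀, y)) xᵢ^d, B (b'₀, y))`
is onto, then the differential of `(regChartCoeffVec, B)` at `(b'₀, y₀)` is onto. [cite: BrockerJanichIDT1982, §5] -/
theorem surjective_fderiv_coeffVec_prod_of_partial {F : Type*} [NormedAddCommGroup F] [NormedSpace ℝ F]
    (B : (ChartIdx n d i → ℂ) → F) (x₀ : {m : DegIndex n d // m ≠ regPowIndex n d i} → ℂ) (y₀ : Fin (n + 1) → ℂ)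
    (hB : DifferentiableAt ℝ B (Sum.elim x₀ y₀))
    (hsurj : Surjective (fderiv ℝ (fun y : Fin (n + 1) → ℂ =>
      (regChartCoeffVec n d i (Sum.elim x₀ y) (regPowIndex n d i), B (Sum.elim x₀ y))) y₀)) :
    Surjective (fderiv ℝ (fun v => (regChartCoeffVec n d i v, B v)) (Sum.elim x₀ y₀)) := by
  set v₀ : ChartIdx n d i → ℂ := Sum.elim x₀ y₀ with hv₀
  have hG : DifferentiableAt ℝ (regChartCoeffVec n d i) v₀ :=
    ((contDiff_regChartCoeffVec n d i).differentiable (by simp)).differentiableAt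
  have hE : DifferentiableAt ℝ (fun v => (regChartCoeffVec n d i v, B v)) v₀ := hG.prodMk hB
  set L := fderiv ℝ (fun v => (regChartCoeffVec n d i v, B v)) v₀ with hL
  -- the partial map is `π ∘ E ∘ (y ↦ (b'₀, y))`, with derivative `π ∘ L ∘ extY`
  set π : ((DegIndex n d → ℂ) × F) →L[ℝ] ℂ × F :=
    ((ContinuousLinearMap.proj (R := ℝ) (regPowIndex n d i)).comp (ContinuousLinearMap.fst ℝ _ F)).prod
      (ContinuousLinearMap.snd ℝ _ F) with hπ
  have hP : HasFDerivAt (fun y : Fin (n + 1) → ℂ =>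
      (regChartCoeffVec n d i (Sum.elim x₀ y) (regPowIndex n d i), B (Sum.elim x₀ y)))
      (π.comp (L.comp (extY n d i))) y₀ := by
    have h1 : HasFDerivAt ((fun v => (regChartCoeffVec n d i v, B v)) ∘
        fun y : Fin (n + 1) → ℂ => (Sum.elim x₀ y : ChartIdx n d i → ℂ)) (L.comp (extY n d i)) y₀ :=
      hE.hasFDerivAt.comp y₀ (hasFDerivAt_sumElim n d i x₀ y₀)
    exact (π.hasFDerivAt.comp y₀ h1).congr_of_eventuallyEq (Filter.Eventually.of_forall fun y => rfl)
  rw [hP.fderiv] at hsurj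
  -- solve the linear system
  rintro ⟨β, f⟩
  set x : ChartIdx n d i → ℂ := Sum.elim (fun m => β m.1) (fun _ => (0 : ℂ)) with hx
  obtain ⟨y, hy⟩ := hsurj (β (regPowIndex n d i) - (L x).1 (regPowIndex n d i), f - (L x).2)
  have hy1 : (L (extY n d i y)).1 (regPowIndex n d i) = β (regPowIndex n d i) - (L x).1 (regPowIndex n d i) :=
    congrArg Prod.fst hy
  have hy2 : (L (extY n d i y)).2 = f - (L x).2 := congrArg Prod.snd hy
  refine ⟨x + extY n d i y, ?_⟩
  rw [map_add, Prod.ext_iff]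
  refine ⟨?_, ?_⟩
  · funext m
    rw [Prod.fst_add, Pi.add_apply]
    by_cases hm : m = regPowIndex n d i
    · subst hm
      rw [hy1]; ring
    · rw [fderiv_coeffVec_apply_of_ne n d i B hB hm, fderiv_coeffVec_apply_of_ne n d i B hB hm, extY_apply_inl, hx]
      simp
  · rw [Prod.snd_add, hy2]; abel

end Literature.AlgebraicGeometry.Motives.UniversalHypersurface

end
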